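import Mathlib
import HarnessLib
import Summits.NavierStokesRegularity.NavierStokesRegularity.Theorems.LrcModEntire.Negative.TwistedColumn
import Summits.NavierStokesRegularity.NavierStokesRegularity.Theorems.LrcModEntire.Negative.FalseWithoutMild

/-!
# Item `LrcModEntire` (stmt-NavierStokesRegularity-20428) — negative side: the TWISTED (TH) COLUMN, V: analyticity and
# the three germ alternatives

Negative-side support (refuter seat ns-regularity-refuter1; D-0081 §C), continuing `…Negative.TwistedColumn`: every
slice of the twisted column profile, its vorticity and every directional derivative of the vorticity are real-analytic on
`ℝ³`; consequently (identity theorem, `…PoloidalWindowRigidity.Negative.GermOffFourStrata.eq_zero_of_eqOn_open`) no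
non-empty open set of any slice `s < 0` carries a vorticity TRANSLATION germ (`twistProfile_no_translation_germ`:
evaluate the entire extension at `0`, `(π/2) e₁`, `e₂/10`), a vertical-axis ROTATION germ (`twistProfile_no_rotation_germ`:
first component of the Killing defect at `(π/2, π/2, 0)`), or an UNBOUNDED ENTIRE germ
(`twistProfile_no_unbounded_entire_germ`: `‖v(s)‖ ≤ 10 (−s)^{-1/2}`).
WHAT THIS IS NOT: not a claim about Navier–Stokes regularity — elementary analysis of a kinematic witness. [folklore]
-/

noncomputable section

-- the summit and its single sub-problem share the name (CONVENTIONS §1), as in every Theorems file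
set_option linter.dupNamespace false

namespace Summit.NavierStokesRegularity.NavierStokesRegularity.Theorems.LrcModEntire.Negative

open MeasureTheory Set Function Filter Topology Metric
open scoped RealInnerProductSpace InnerProductSpace
open Literature.Analysis Literature.Analysis.FluidPDE
open Summit.NavierStokesRegularity.NavierStokesRegularity.Theorems.PoloidalWindowRigidity.Negative

local notation "E3" => EuclideanSpace ℝ (Fin 3)
local notation "π" i => (EuclideanSpace.proj (𝕜 := ℝ) (i : Fin 3) : EuclideanSpace ℝ (Fin 3) →L[ℝ] ℝ)
local notation "𝐞" i => (EuclideanSpace.single (i : Fin 3) (1 : ℝ) : EuclideanSpace ℝ (Fin 3))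

/-! ## Real-analyticity of the slices, of their vorticity and of its derivatives -/

/-- The profile slice in the standard basis. [folklore] -/
theorem twistProfile_eq_sum (s : ℝ) (x : E3) : twistProfile s x =
    (cellAmp s * -(twistP₁ (x 2) * Real.sin (x 0))) • (𝐞 0) +
      (cellAmp s * -(twistQ₁ (x 2) * Real.sin (x 1))) • (𝐞 1) +
      (cellAmp s * (twistP (x 2) * Real.cos (x 0) + twistQ (x 2) * Real.cos (x 1))) • (𝐞 2) := by
  ext i
  fin_cases i <;> simp [twistProfile, twistField_apply_zero, twistField_apply_one, twistField_apply_two]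

/-- **Every slice of the twisted column profile is real-analytic on `ℝ³`.** [folklore] -/
theorem analyticOnNhd_twistProfile (s : ℝ) : AnalyticOnNhd ℝ (twistProfile s) univ := by
  intro x _
  have hY := fun k => analyticAt_coord k x
  have hP1 : AnalyticAt ℝ (fun y : E3 => twistP₁ (y 2)) x := ((analyticAt_twistP₁ _).comp (hY 2) :)
  have hQ1 : AnalyticAt ℝ (fun y : E3 => twistQ₁ (y 2)) x := ((analyticAt_twistQ₁ _).comp (hY 2) :)
  have hP : AnalyticAt ℝ (fun y : E3 => twistP (y 2)) x := ((analyticAt_twistP _).comp (hY 2) :)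
  have hQ : AnalyticAt ℝ (fun y : E3 => twistQ (y 2)) x := ((analyticAt_twistQ _).comp (hY 2) :)
  have hs0 : AnalyticAt ℝ (fun y : E3 => Real.sin (y 0)) x := (Real.analyticAt_sin.comp (hY 0) :)
  have hs1 : AnalyticAt ℝ (fun y : E3 => Real.sin (y 1)) x := (Real.analyticAt_sin.comp (hY 1) :)
  have hc0 : AnalyticAt ℝ (fun y : E3 => Real.cos (y 0)) x := (Real.analyticAt_cos.comp (hY 0) :)
  have hc1 : AnalyticAt ℝ (fun y : E3 => Real.cos (y 1)) x := (Real.analyticAt_cos.comp (hY 1) :)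
  have e : twistProfile s = fun x =>
      (cellAmp s * -(twistP₁ (x 2) * Real.sin (x 0))) • (𝐞 0) +
        (cellAmp s * -(twistQ₁ (x 2) * Real.sin (x 1))) • (𝐞 1) +
        (cellAmp s * (twistP (x 2) * Real.cos (x 0) + twistQ (x 2) * Real.cos (x 1))) • (𝐞 2) :=
    funext (twistProfile_eq_sum s)
  rw [e]
  exact (((analyticAt_const.mul (hP1.mul hs0).neg).smul analyticAt_const).add
    ((analyticAt_const.mul (hQ1.mul hs1).neg).smul analyticAt_const)).add
    ((analyticAt_const.mul ((hP.mul hc0).add (hQ.mul hc1))).smul analyticAt_const)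

/-- **The vorticity of every slice is real-analytic on `ℝ³`.** [folklore] -/
theorem analyticOnNhd_curl_twistProfile (s : ℝ) : AnalyticOnNhd ℝ (curl (twistProfile s)) univ := by
  intro x _
  have hY := fun k => analyticAt_coord k x
  have hm : AnalyticAt ℝ (fun y : E3 => twistSlope (y 2)) x := ((analyticAt_twistSlope _).comp (hY 2) :)
  have hP : AnalyticAt ℝ (fun y : E3 => twistP (y 2)) x := ((analyticAt_twistP _).comp (hY 2) :)
  have hQ : AnalyticAt ℝ (fun y : E3 => twistQ (y 2)) x := ((analyticAt_twistQ _).comp (hY 2) :)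
  have hs0 : AnalyticAt ℝ (fun y : E3 => Real.sin (y 0)) x := (Real.analyticAt_sin.comp (hY 0) :)
  have hs1 : AnalyticAt ℝ (fun y : E3 => Real.sin (y 1)) x := (Real.analyticAt_sin.comp (hY 1) :)
  have e : curl (twistProfile s) = fun x =>
      (cellAmp s * ((twistSlope (x 2) - 1) * twistQ (x 2) * Real.sin (x 1))) • (𝐞 0) +
        (cellAmp s * -((twistSlope (x 2) - 1) * twistP (x 2) * Real.sin (x 0))) • (𝐞 1) := by
    funext x
    rw [curl_twistProfile, twistVort, smul_add, smul_smul, smul_smul]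
  rw [e]
  exact ((analyticAt_const.mul (((hm.sub analyticAt_const).mul hQ).mul hs1)).smul analyticAt_const).add
    ((analyticAt_const.mul (((hm.sub analyticAt_const).mul hP).mul hs0).neg).smul analyticAt_const)

/-- **Every directional derivative of the vorticity of every slice is real-analytic on `ℝ³`.** [folklore] -/
theorem analyticOnNhd_fderiv_curl_twistProfile_apply (s : ℝ) (e : E3) :
    AnalyticOnNhd ℝ (fun y => fderiv ℝ (curl (twistProfile s)) y e) univ :=
  (ContinuousLinearMap.apply ℝ (EuclideanSpace ℝ (Fin 3)) e).comp_analyticOnNhd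
    (analyticOnNhd_curl_twistProfile s).fderiv

/-! ## No window of any slice carries a Killing germ or an unbounded entire germ -/

/-- **No translation germ**: on no non-empty open set of any slice `s < 0` does a directional derivative of the
vorticity in a fixed non-zero direction vanish (evaluate the entire extension at `0`, `(π/2) e₁`, `e₂/10`). [folklore] -/
theorem twistProfile_no_translation_germ {s : ℝ} (hs : s < 0) {U : Set E3} (hU : IsOpen U) (hne : U.Nonempty)
    {e : E3} (he : e ≠ 0) (h : ∀ y ∈ U, fderiv ℝ (curl (twistProfile s)) y e = 0) : False := by
  obtain ⟨y₀, hy₀⟩ := hne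
  have hglob := eq_zero_of_eqOn_open (analyticOnNhd_fderiv_curl_twistProfile_apply s e) hU hy₀ h
  have hc := cellAmp_pos hs
  have hm0 := twistSlope_sub_one_ne_zero 0
  have hcm : cellAmp s * (twistSlope 0 - 1) ≠ 0 := mul_ne_zero hc.ne' hm0
  have p10 : ((Real.pi / 2) • (𝐞 1) : E3) 0 = 0 := by simp
  have p11 : ((Real.pi / 2) • (𝐞 1) : E3) 1 = Real.pi / 2 := by simp
  have p12 : ((Real.pi / 2) • (𝐞 1) : E3) 2 = 0 := by simp
  have q0 : (((1 / 10 : ℝ)) • (𝐞 2) : E3) 0 = 0 := by simp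
  have q1 : (((1 / 10 : ℝ)) • (𝐞 2) : E3) 1 = 0 := by simp
  have q2 : (((1 / 10 : ℝ)) • (𝐞 2) : E3) 2 = 1 / 10 := by simp
  -- at `y = 0`, second component: `−(−s)^{-1/2} (m(0) − 1) P(0) e₀ = 0`
  have h0' : e 0 = 0 := by
    have h0 : fderiv ℝ (curl (twistProfile s)) 0 e 1 = 0 := by rw [hglob 0, PiLp.zero_apply]
    rw [fderiv_curl_twistProfile_apply_one, PiLp.zero_apply, PiLp.zero_apply, Real.sin_zero, Real.cos_zero,
      twistP_zero] at h0
    have : cellAmp s * (twistSlope 0 - 1) * e 0 = 0 := by linear_combination -3 * h0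
    rcases mul_eq_zero.1 this with h' | h'
    · exact absurd h' hcm
    · exact h'
  -- at `y = (π/2) e₁`, first component: `3 (−s)^{-1/2} (m(0) − 1) e₂ = 0`
  have h2 : e 2 = 0 := by
    have h0 : fderiv ℝ (curl (twistProfile s)) ((Real.pi / 2) • (𝐞 1)) e 0 = 0 := by
      rw [hglob _, PiLp.zero_apply]
    rw [fderiv_curl_twistProfile_apply_zero, p11, p12, Real.sin_pi_div_two, Real.cos_pi_div_two, twistQ_zero,
      twistQ₁_zero, twistSlopeD_zero] at h0
    have : cellAmp s * (twistSlope 0 - 1) * e 2 = 0 := by linear_combination (1 / 3 : ℝ) * h0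
    rcases mul_eq_zero.1 this with h' | h'
    · exact absurd h' hcm
    · exact h'
  -- at `y = e₂/10`, first component: `(−s)^{-1/2} (m(1/10) − 1) Q(1/10) e₁ = 0`
  have h1 : e 1 = 0 := by
    have hQ : 0 < twistQ (1 / 10) := twistQ_pos (by norm_num) (by norm_num)
    have hm1 := twistSlope_sub_one_ne_zero (1 / 10)
    have h0 : fderiv ℝ (curl (twistProfile s)) ((1 / 10 : ℝ) • (𝐞 2)) e 0 = 0 := by
      rw [hglob _, PiLp.zero_apply]
    rw [fderiv_curl_twistProfile_apply_zero, q1, q2, Real.sin_zero, Real.cos_zero, h2] at h0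
    have : cellAmp s * (twistSlope (1 / 10) - 1) * twistQ (1 / 10) * e 1 = 0 := by linear_combination h0
    rcases mul_eq_zero.1 this with h' | h'
    · rcases mul_eq_zero.1 h' with h'' | h''
      · exact absurd h'' (mul_ne_zero hc.ne' hm1)
      · exact absurd h'' hQ.ne'
    · exact h'
  apply he
  ext i
  fin_cases i
  · simpa using h0'
  · simpa using h1
  · simpa using h2

/-- **No rotation germ about a vertical axis**: on no non-empty open set of any slice `s < 0` does the vorticity
satisfy the infinitesimal Killing equation `J curl v(s)(y) = D(curl v(s))(y) J(y − c)` of the rotations about the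
vertical axis through `c` (first component of the entire Killing defect at `(π/2, π/2, 0)`:
`(−s)^{-1/2} (m(0) − 1)/3 = 0`). [folklore] -/
theorem twistProfile_no_rotation_germ {s : ℝ} (hs : s < 0) {U : Set E3} (hU : IsOpen U) (hne : U.Nonempty)
    (c : E3) (h : ∀ y ∈ U, rotGen (curl (twistProfile s) y) = fderiv ℝ (curl (twistProfile s)) y (rotGen (y - c))) :
    False := by
  obtain ⟨y₀, hy₀⟩ := hne
  have hc := cellAmp_pos hs
  have hm0 := twistSlope_sub_one_ne_zero 0
  -- the first component of the Killing defect, written out: an entire function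
  set φ : E3 → ℝ := fun y =>
    cellAmp s * ((twistSlope (y 2) - 1) * twistP (y 2) * Real.sin (y 0)) -
      cellAmp s * (((twistSlope (y 2) - 1) * twistQ (y 2)) * (Real.cos (y 1) * (y 0 - c 0))) with hφ
  have hφa : AnalyticOnNhd ℝ φ univ := by
    intro y _
    have hY := fun k => analyticAt_coord k y
    have hm : AnalyticAt ℝ (fun y : E3 => twistSlope (y 2)) y := ((analyticAt_twistSlope _).comp (hY 2) :)
    have hP : AnalyticAt ℝ (fun y : E3 => twistP (y 2)) y := ((analyticAt_twistP _).comp (hY 2) :)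
    have hQ : AnalyticAt ℝ (fun y : E3 => twistQ (y 2)) y := ((analyticAt_twistQ _).comp (hY 2) :)
    exact (analyticAt_const.mul (((hm.sub analyticAt_const).mul hP).mul (Real.analyticAt_sin.comp (hY 0)))).sub
      (analyticAt_const.mul (((hm.sub analyticAt_const).mul hQ).mul ((Real.analyticAt_cos.comp (hY 1)).mul
        ((hY 0).sub analyticAt_const))))
  have hφU : ∀ y ∈ U, φ y = 0 := fun y hy => by
    have hy' := congrArg (fun w : E3 => w 0) (h y hy)
    dsimp only at hy'
    rw [rotGen_apply_zero, curl_twistProfile_apply_one, fderiv_curl_twistProfile_apply_zero, rotGen_apply_one,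
      rotGen_apply_two, PiLp.sub_apply] at hy'
    rw [hφ]
    linear_combination hy'
  have p0 : ((Real.pi / 2) • (𝐞 0) + (Real.pi / 2) • (𝐞 1) : E3) 0 = Real.pi / 2 := by simp
  have p1 : ((Real.pi / 2) • (𝐞 0) + (Real.pi / 2) • (𝐞 1) : E3) 1 = Real.pi / 2 := by simp
  have p2 : ((Real.pi / 2) • (𝐞 0) + (Real.pi / 2) • (𝐞 1) : E3) 2 = 0 := by simp
  have h0 := eq_zero_of_eqOn_open hφa hU hy₀ hφU ((Real.pi / 2) • (𝐞 0) + (Real.pi / 2) • (𝐞 1))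
  rw [hφ] at h0
  dsimp only at h0
  rw [p0, p1, p2, Real.sin_pi_div_two, Real.cos_pi_div_two, twistP_zero] at h0
  have : cellAmp s * (twistSlope 0 - 1) = 0 := by linear_combination 3 * h0
  exact mul_ne_zero hc.ne' hm0 this

/-- **No unbounded entire germ**: an entire real-analytic field agreeing with a slice of the witness on a non-empty
open set is the slice itself, hence bounded (`‖v(s)‖ ≤ 10 (−s)^{-1/2}`). [folklore] -/
theorem twistProfile_no_unbounded_entire_germ (s : ℝ) {U : Set E3} (hU : IsOpen U) (hne : U.Nonempty)
    {w : E3 → E3} (hw : AnalyticOnNhd ℝ w univ) (hwU : ∀ y ∈ U, twistProfile s y = w y) :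
    BddAbove (Set.range fun y => ‖w y‖) := by
  obtain ⟨y₀, hy₀⟩ := hne
  have hglob := eq_zero_of_eqOn_open (hw.sub (analyticOnNhd_twistProfile s)) hU hy₀
    (fun y hy => by simp [hwU y hy])
  refine ⟨cellAmp s * 10, ?_⟩
  rintro _ ⟨y, rfl⟩
  have hy : w y = twistProfile s y := by
    have h := hglob y
    simp only [Pi.sub_apply, sub_eq_zero] at h
    exact h
  show ‖w y‖ ≤ cellAmp s * 10
  rw [hy]
  exact norm_twistProfile_le s y

end Summit.NavierStokesRegularity.NavierStokesRegularity.Theorems.LrcModEntire.Negative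

end
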